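import Literature.NumberTheory.EllipticCurves.BSDRankZeroGoodTwistFamily
import Literature.NumberTheory.EllipticCurves.BSDRankZeroDensityProofs
import Literature.NumberTheory.EllipticCurves.QuadraticTwistNegOneRootNumberProofs
import HarnessLib

/-!
# Bhargava–Shankar, Theorem 4: the root-number family from the Modularity Theorem — assembly

Sibling proof file of `BSDRankZeroGoodTwistFamily` (the two congruence families `G`, `G₋₁`: the
`2`-adic class `A ≡ −16`, `B ≡ ±16 (mod 64)` of `E_{−16,16} ≅ 37a1`, `4A³ + 27B²` squarefree away
from `2` and negative). Here:

* `rootNumber_negB_of_isGTFamily` : **`w(E_{A,−B}) = −w(E_{A,B})` on `G ∪ G₋₁` from the Modularity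
  Theorem** `exists_isNewformOf` — for `E = E_{A,B} ∈ G`, `E` has odd conductor `N ≡ 1 (mod 4)` and
  `E^{(−1)} = E_{A,−B}` is additive at `2` (`ShortWeierstrassGoodTwistLocalProofs`), so
  `aₙ(E^{(−1)}) = χ₋₄(n) aₙ(E)` and Atkin–Lehner–Li twisting of the newform of `E` by the primitive
  character `χ₋₄` of conductor `4 ∤ N` gives `w(E^{(−1)}) = χ₋₄(−N) w(E) = −w(E)` (Murty–Murty 1997,
  Ch. 6 §1, `D = −4`; `rootNumber_quadraticTwist_neg_one_of_mod_four_eq_one` of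
  `QuadraticTwistNegOneRootNumberProofs`);
* `exists_isLarge_rootNumber_twist_family_of_exists_isNewformOf` : the composite existence fact
  `exists_isLarge_rootNumber_twist_family` of `BSDRankZeroDensity` (Bhargava–Shankar §4.1: "an
  explicit positive proportion large family `F` … for which exactly `50%` of the curves have root
  number `1`"), from `exists_isNewformOf` alone;
* `pos_proportion_rank_zero_of_facts₄` : **Thm 4 of Bhargava–Shankar** (ternary cubic forms paper,
  Ann. of Math. 181 (2015); `Literature.NumberTheory.EllipticCurves.pos_proportion_rank_zero`) from
  Thm 27 (`heightAverageOn_card_selmerThree_le_four`), the `p`-parity theorem (`p_parity`,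
  Dokchitser–Dokchitser = the source's Thm 42 via `even_selmerRank_sub_torsionRank_iff_of_facts`),
  the Cassels–Tate pairing (`exists_casselsTate_pairing`) and the Modularity Theorem
  (`exists_isNewformOf`). Compared with `pos_proportion_rank_zero_of_facts₃` (`BSDRankZeroAssembly`),
  the bespoke root-number sentence of §4.1 (`rootNumber_negB_of_isBSFamily`, S. Wong's local root
  numbers at `2`) is no longer an input.

Everything here is proved; no definitions and no named facts are introduced (D-0026).

## References

* [BhargavaShankarTernary2015] M. Bhargava, A. Shankar, Ann. of Math. 181 (2015), 587–621
  (arXiv:1007.0052v2), Thm 4, Thm 27, Thm 41–42 and §4.1.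
* [MurtyMurty1997] M. R. Murty, V. K. Murty, *Non-vanishing of `L`-functions and applications*
  (1997), Ch. 6, §1.
-/

noncomputable section

open scoped Classical
open Filter Finset WeierstrassCurve
open Literature.NumberTheory.EllipticCurves.RankZeroSieve Literature.NumberTheory.EllipticCurves.ModularForms

namespace Literature.NumberTheory.EllipticCurves

/-! ### The root number changes sign under the twist by `−1` on `G ∪ G₋₁` (from Modularity) -/

section RootNumber

/-- **`w(E_{A,−B}) = −w(E_{A,B})` on the base piece `G`, from the Modularity Theorem.** For
`A = 64k − 16`, `B = 64m + 16` with `4A³ + 27B²` squarefree away from `2` and negative, `E = E_{A,B}`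
has odd conductor `N ≡ 1 (mod 4)` and `E^{(−1)} = E_{A,−B}` is additive at `2`
(`ShortWeierstrassGoodTwistLocalProofs`), so `w(E^{(−1)}) = −χ₄(N) w(E) = −w(E)`
(`rootNumber_quadraticTwist_neg_one_of_mod_four_eq_one`; Murty–Murty 1997, Ch. 6 §1 with `D = −4`).
[cite: MurtyMurty1997, Ch. 6 §1] -/
theorem rootNumber_negB_goodTwistClass (hmod : exists_isNewformOf) (k m : ℤ)
    (hsq : OddSqfree (64 * k - 16, 64 * m + 16)) (hneg : negDisc (64 * k - 16, 64 * m + 16) < 0) :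
    (shortWeierstrass (64 * k - 16, -(64 * m + 16))).rootNumber =
      -(shortWeierstrass (64 * k - 16, 64 * m + 16)).rootNumber := by
  haveI := isElliptic_shortWeierstrass_of_negDisc_ne_zero (negDisc_goodTwistClass_ne_zero k m)
  rw [← quadraticTwist_neg_one_shortWeierstrass]
  exact rootNumber_quadraticTwist_neg_one_of_mod_four_eq_one _ hmod
    (conductorNorm_goodTwistClass_mod_four k m hsq hneg)
    (fun w hw ↦ hasAdditiveReductionAt_quadraticTwist_neg_one_goodTwistClass k m w hw)

/-- **`w(E_{A,−B}) = −w(E_{A,B})` on both pieces** (on `G₋₁` read the identity for `G` backwards,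
`w = ±1`). [cite: MurtyMurty1997, Ch. 6 §1] -/
theorem rootNumber_negB_of_isGTFamily (hmod : exists_isNewformOf) (t : Bool) (AB : ℤ × ℤ)
    (h : IsGTFamily t AB) :
    (shortWeierstrass (negB AB)).rootNumber = -(shortWeierstrass AB).rootNumber := by
  obtain ⟨k, m, hA, hB⟩ := h.exists_eq
  obtain ⟨A, B⟩ := AB
  simp only at hA hB
  have hsq := h.2.2.1
  have hneg := h.2.2.2
  subst hA
  cases t
  · simp only [Bool.false_eq_true, ↓reduceIte] at hB
    subst hB
    have hsq' : OddSqfree (64 * k - 16, 64 * m + 16) :=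
      (oddSqfree_negB_iff (64 * k - 16, 64 * m + 16)).mp hsq
    have hneg' : negDisc (64 * k - 16, 64 * m + 16) < 0 := by
      rw [← negDisc_negB]; exact hneg
    have h' := rootNumber_negB_goodTwistClass hmod k m hsq' hneg'
    change (shortWeierstrass (64 * k - 16, -(-(64 * m + 16)))).rootNumber = _
    rw [neg_neg, h', neg_neg]
  · simp only [↓reduceIte] at hB
    subst hB
    exact rootNumber_negB_goodTwistClass hmod k m hsq hneg

end RootNumber

/-! ### Assembly -/

section Assembly

/-- **The root-number family of §4.1, realised from the Modularity Theorem.** The composite existence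
fact `exists_isLarge_rootNumber_twist_family` of `BSDRankZeroDensity` ("an explicit positive
proportion large family `F` of elliptic curves for which exactly `50%` of the curves have root
number `1`": finitely many pairwise disjoint large congruence families whose union is stable under
`E ↦ E₋₁`, reverses the root number under it, and has positive proportion) holds, with the union
`G ∪ G₋₁` of this file, granted only the Modularity Theorem `exists_isNewformOf`.
[cite: BhargavaShankarTernary2015, §4.1 (arXiv v2), construction of F] -/
theorem exists_isLarge_rootNumber_twist_family_of_exists_isNewformOf (hmod : exists_isNewformOf) :
    exists_isLarge_rootNumber_twist_family := by
  refine ⟨2, gtFamilies, ?_, gtFamilies_disjoint, fun AB ↦ unionMem_gtFamilies_negB, ?_,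
    exists_pos_le_heightProportion_unionMem_gtFamilies⟩
  · intro i
    fin_cases i
    · exact isLarge_gtFamily true
    · exact isLarge_gtFamily false
  · intro AB hAB
    rw [unionMem_gtFamilies_iff] at hAB
    rcases hAB with h' | h'
    · exact rootNumber_negB_of_isGTFamily hmod true AB h'
    · exact rootNumber_negB_of_isGTFamily hmod false AB h'

/-- **Theorem 4 of Bhargava–Shankar from Thm 27, `p`-parity, Cassels–Tate and Modularity.** "When all
elliptic curves `E/ℚ` are ordered by height, a positive proportion of them have rank `0`"
(`Literature.NumberTheory.EllipticCurves.pos_proportion_rank_zero`) follows from: (h₁) Thm 27 of the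
source, the average of `#Sel^(3)` over every large congruence family is eventually `≤ 4 + ε`
(`heightAverageOn_card_selmerThree_le_four`); (hpar) the `p`-parity theorem `p_parity`
(Dokchitser–Dokchitser 2010, Thm 1.4, the source's Thm 42 via
`even_selmerRank_sub_torsionRank_iff_of_facts`); (hCT) the Cassels–Tate pairing
`exists_casselsTate_pairing`; (hmod) the Modularity Theorem `exists_isNewformOf`, which replaces the
source's §4.1 root-number computation (`exists_isLarge_rootNumber_twist_family_of_exists_isNewformOf`).
Composition with `pos_proportion_rank_zero_of_facts` (`BSDRankZeroDensity`).
[cite: BhargavaShankarTernary2015, Thm 4, Thm 27, Thm 41–42 and §4.1 (arXiv v2 numbering)] -/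
theorem pos_proportion_rank_zero_of_facts₄ (h₁ : heightAverageOn_card_selmerThree_le_four)
    (hpar : ∀ (W : WeierstrassCurve ℚ) [W.IsElliptic] (p : ℕ) [Fact p.Prime], p_parity W p)
    (hCT : WeierstrassCurve.exists_casselsTate_pairing (K := ℚ))
    (hmod : exists_isNewformOf) : pos_proportion_rank_zero :=
  pos_proportion_rank_zero_of_facts h₁ (exists_isLarge_rootNumber_twist_family_of_exists_isNewformOf hmod)
    (even_selmerRank_sub_torsionRank_iff_of_facts hpar hCT)

end Assembly

end Literature.NumberTheory.EllipticCurves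

end
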